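import Mathlib

/-!
# `SmallCaseThreeFive` (stmt-ValiantsHypothesis-5644), line `Sketch` — stub `stub_mapMatrix_pencil`

Bookkeeping for the transfer "universal nilpotency ⇒ ideal membership": the generic `5 × 5`
affine pencil has entries `C (X (none,(i,j))) + Σ_e X e * C (X (some e,(i,j)))` over the
coefficient ring `S = MvPolynomial (unknowns) ℂ`; pushing the coefficients through a ring map
`f : S →+* T` (`RingHom.mapMatrix` of `MvPolynomial.map f`) gives the pencil whose unknowns are
the images `f (X u)`.
-/

noncomputable section
set_option linter.dupNamespace false

namespace Summit.ValiantsHypothesis.ValiantsHypothesis.Theorems.RefutationDegreeSmallCaseThreeFive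

open MvPolynomial
open scoped BigOperators Matrix

/-- Pushing the coefficients of the generic pencil `A₀ + Σ_e x_e A_e` through a ring map
`f : S →+* T` (entrywise `MvPolynomial.map f`) yields the pencil with entries
`C (f A₀_{ij}) + Σ_e x_e · C (f (A_e)_{ij})`. -/
theorem stub_mapMatrix_pencil {T : Type*} [CommRing T]
    (f : MvPolynomial (Option (Fin 3 × Fin 3) × (Fin 5 × Fin 5)) ℂ →+* T) :
    (MvPolynomial.map f).mapMatrix
        (Matrix.of fun i j : Fin 5 =>
          C (X (none, (i, j))) + ∑ e : Fin 3 × Fin 3, X e * C (X (some e, (i, j))) :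
            Matrix (Fin 5) (Fin 5) (MvPolynomial (Fin 3 × Fin 3)
              (MvPolynomial (Option (Fin 3 × Fin 3) × (Fin 5 × Fin 5)) ℂ))) =
      Matrix.of fun i j : Fin 5 =>
        C (f (X (none, (i, j)))) + ∑ e : Fin 3 × Fin 3, X e * C (f (X (some e, (i, j)))) := by
  ext i j
  simp only [RingHom.mapMatrix_apply, Matrix.map_apply, Matrix.of_apply, map_add, map_sum,
    map_mul, map_X, map_C]

end Summit.ValiantsHypothesis.ValiantsHypothesis.Theorems.RefutationDegreeSmallCaseThreeFive
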